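import Summits.ResolutionOfSingularities.ResolutionOfSingularities.Theses.TeissierJung
import Literature.AlgebraicGeometry.Resolution.TeissierPresentation
import Literature.AlgebraicGeometry.Resolution.NonReducedNoResolution
import Literature.AlgebraicGeometry.Resolution.ProjectiveSpaceRegular

/-!
# `TeissierResolve` — negative lemmas I: reducedness of `X'` is load-bearing

Support (negative) lemmas for the crux `stmt-ResolutionOfSingularities-17086`
(`Summit.ResolutionOfSingularities.ResolutionOfSingularities.Theses.TeissierJung.TeissierResolve`,
route `TeissierJung`, rank 3), filed by the standing disprover (cdisprove gen 1, cycle 1; work file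
`Cruxes/TeissierResolve/Disproof.lean`). The crux reads (`teissierResolve_iff`, via
`Literature.AlgebraicGeometry.Resolution.teissierPresented_iff`, whose right-hand side is the
let-bound predicate `TF` of the route VERBATIM):

  `∀ p prime, ∀ k algebraically closed of characteristic p, ∀ X',`
  `TeissierPresented k X' → Scheme.HasResolution X'`,

where `TeissierPresented k X'` says: `X'` is INTEGRAL and finite over a regular integral separated
`k`-scheme `S` of finite type, and at every closed point `x`, for every minimal prime `P` of the
completed local ring `𝒪̂_{X',x}`, the analytic branch `𝒪̂_{X',x} ⧸ P` carries a Teissier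
presentation (Mourtada–Schober 2025, §3) over an isomorphism `𝒪̂_{S,π x} ≅ k⟦x₁, …, x_d⟧`.

The file declares NO definition; the one mutated variant of the crux is written out inline.

## Findings (all sorry-free)

* `teissierResolve_iff` — the crux in terms of the Literature predicate `TeissierPresented`.
* `not_resolutionOfSingularities_of_not_teissierResolve` — IRREFUTABILITY relative to the summit:
  a Teissier-presented `X'` is reduced, separated and of finite type over `k`, so
  `ResolutionOfSingularities → TeissierResolve`; no refutation of the crux exists short of a
  counterexample to resolution of singularities in characteristic `p` (dimension `≥ 4`, since the
  crux in dimension `≤ 3` follows from `CossartPiltant2019`).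
* `specDualNumber_teissierBranches` — THE WITNESS: the fat point `Spec k[ε] → Spec k` (any field
  `k`) satisfies every conjunct of `TF` except reducedness: `Spec k` is a regular integral
  separated `k`-scheme of finite type, the structure map is finite, `Spec k[ε]` is irreducible,
  and at its unique point the completed local ring is `k[ε]` (Artinian local rings are adically
  complete), whose unique (minimal) prime is `(ε)` with branch `k[ε]/(ε) = k = k⟦∅⟧`,
  Teissier-presented with `d = g = 0` compatibly with `𝒪̂_{Spec k} = k` (the compatibility with
  the stalk map of `π` is the naturality `stalkMap_stalkIso_inv_algebraMap` of
  `R → R_𝔭 ≅ 𝒪_{Spec R,𝔭}`; the algebra is `bijective_quotient_adicCompletion_of_isArtinianRing`: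
  for an Artinian local `A` with `A = j(k) + 𝔪`, every branch `Â ⧸ P` is `k`).
* `teissierResolve_false_without_isReduced` (every prime `p`; primed version with the crux's own
  quantifier prefix) — THE NEGATIVE LEMMA: with `IsIntegral X'` weakened to `IrreducibleSpace X'`
  (a weakening of the hypothesis, `teissierPresented_weaken_isIntegral`, hence a strengthening of
  the crux) the statement is FALSE: `Spec 𝔽̄_p[ε]` has no resolution
  (`Literature.AlgebraicGeometry.Resolution.not_hasResolution_spec_dualNumber`: a dense open of a
  point is everything, so the non-reduced stalk `k[ε]` would be regular).

MORAL (for provers of the crux). The branch condition of `TF` only sees `𝒪̂_{X',x}` modulo its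
MINIMAL primes, so it is blind to nilpotent (and embedded) structure; "any proof must use that
`X'` is reduced". Concretely a proof has to control `𝒪̂_{X',x}` itself: for `X'` integral and
finite over the excellent regular `S`, `𝒪_{X',x}` is reduced and essentially of finite type over
`k`, hence a G-ring whose completion is again reduced (Matsumura 1986, §32, Remark 1 after
Thm. 32.6: "reduced and normal pass to the completion"), so `𝒪̂_{X',x}` embeds into the finite
product of its Teissier branches `∏_P 𝒪̂ ⧸ P` — the form in which the branchwise (formal, toric)
resolutions of Mourtada–Schober Thm. 3.2 can at all be assembled; without reducedness of `X'`
this embedding, and the crux, fail.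

## Sources
* H. Mourtada, B. Schober, *Teissier singularities*, C. R. Math. 363 (2025) = arXiv:2502.01239,
  §3 (the presentation), Prop. 3.1, Thm. 3.2 (announced). [MourtadaSchober2025]
* H. Matsumura, *Commutative Ring Theory*, CUP 1986, §32 Remark 1 (local rings essentially of
  finite type over a field are G-rings; reduced and normal pass to the completion), §33
  (Krull–Akizuki: a one-dimensional Noetherian local domain has reduced completion iff its
  normalisation is finite). [Matsumura1986]
* The Stacks Project, Tag 01RN (birational), Tag 02IS (regular schemes).
* Tree: `Literature/AlgebraicGeometry/Resolution/NonReducedNoResolution.lean`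
  (`not_hasResolution_spec_dualNumber`), `…/TeissierPresentation.lean` (`teissierPresented_iff`,
  `TeissierPresentation.mvPowerSeries`), `…/ProjectiveSpaceRegular.lean` (`Scheme.isRegular_Spec`).
-/

noncomputable section

open CategoryTheory AlgebraicGeometry TopologicalSpace IsLocalRing
open Literature.AlgebraicGeometry.Resolution

set_option linter.dupNamespace false

namespace Summit.ResolutionOfSingularities.ResolutionOfSingularities.Theorems.TeissierResolve.Negative

universe u

/-! ## Algebra: the branches of the completion of an Artinian local `k`-algebra with residue
field `k` are `k` -/

/-- Let `A` be an Artinian local ring and `j : k → A` a ring map from a field such that every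
element of `A` is congruent to an element of `j(k)` modulo the maximal ideal. Then for every prime
`P` of the `𝔪`-adic completion `Â` (which is `A` itself), the composite `k → A → Â → Â ⧸ P` is
bijective: the analytic branches of `A` are all reduced to the residue field. [folklore] -/
theorem bijective_quotient_adicCompletion_of_isArtinianRing {k A : Type*} [Field k] [CommRing A]
    [IsLocalRing A] [IsArtinianRing A] (j : k →+* A)
    (hj : ∀ a : A, ∃ c : k, a - j c ∈ maximalIdeal A)
    (P : Ideal (AdicCompletion (maximalIdeal A) A)) [hP : P.IsPrime] :
    Function.Bijective ((Ideal.Quotient.mk P).comp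
      ((algebraMap A (AdicCompletion (maximalIdeal A) A)).comp j)) := by
  haveI : Nontrivial (AdicCompletion (maximalIdeal A) A ⧸ P) :=
    Ideal.Quotient.nontrivial_iff.mpr hP.ne_top
  refine ⟨RingHom.injective _, fun y => ?_⟩
  obtain ⟨z, rfl⟩ := Ideal.Quotient.mk_surjective y
  obtain ⟨a, rfl⟩ := (AdicCompletion.of_bijective (maximalIdeal A) A).2 z
  obtain ⟨c, hc⟩ := hj a
  obtain ⟨n, hn⟩ := (isArtinianRing_iff_isNilpotent_maximalIdeal A).mp inferInstance
  have hnil : IsNilpotent (j c - a) := by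
    refine ⟨n, ?_⟩
    have hmem : (j c - a) ^ n ∈ maximalIdeal A ^ n :=
      Ideal.pow_mem_pow (by simpa using (maximalIdeal A).neg_mem hc) n
    rw [hn] at hmem
    simpa using hmem
  refine ⟨c, ?_⟩
  change Ideal.Quotient.mk P (algebraMap A _ (j c)) = Ideal.Quotient.mk P (algebraMap A _ a)
  rw [Ideal.Quotient.eq, ← map_sub]
  exact nilradical_le_prime P (mem_nilradical.mpr (hnil.map _))

/-- `k ≅ k⟦x_1, …, x_0⟧`: constants are everything in no variables. [folklore] -/
theorem bijective_C_mvPowerSeries_fin_zero (k : Type*) [Field k] :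
    Function.Bijective (MvPowerSeries.C : k →+* MvPowerSeries (Fin 0) k) := by
  refine ⟨MvPowerSeries.C_injective, fun f => ⟨MvPowerSeries.constantCoeff f, ?_⟩⟩
  ext e
  rw [Subsingleton.elim e 0]
  simp

/-! ## Stalks of `Spec` of an Artinian ring -/

/-- Naturality of `R → R_𝔭 ≅ 𝒪_{Spec R, 𝔭}` under `Spec.map`. [folklore] -/
theorem stalkMap_stalkIso_inv_algebraMap {R S : CommRingCat.{u}} (f : R ⟶ S) (p : PrimeSpectrum S)
    (r : R) :
    ((Spec.map f).stalkMap p).hom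
        ((Spec.stalkIso R (p.comap f.hom)).inv.hom
          (algebraMap R (Localization.AtPrime (p.comap f.hom).asIdeal) r)) =
      (Spec.stalkIso S p).inv.hom (algebraMap S (Localization.AtPrime p.asIdeal) (f.hom r)) := by
  have h0 : (Spec.stalkIso R (p.comap f.hom)).inv ≫ (Spec.map f).stalkMap p =
      CommRingCat.ofHom (Localization.localRingHom (p.comap f.hom).asIdeal p.asIdeal f.hom rfl) ≫
        (Spec.stalkIso S p).inv := by
    rw [← Scheme.localRingHom_comp_stalkIso f p, Iso.inv_hom_id_assoc]
  have h1 := RingHom.congr_fun (CommRingCat.hom_ext_iff.mp h0)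
    (algebraMap R (Localization.AtPrime (p.comap f.hom).asIdeal) r)
  have h2 : ((Spec.map f).stalkMap p).hom
      ((Spec.stalkIso R (p.comap f.hom)).inv.hom
        (algebraMap R (Localization.AtPrime (p.comap f.hom).asIdeal) r)) =
      (Spec.stalkIso S p).inv.hom (Localization.localRingHom (p.comap f.hom).asIdeal p.asIdeal
        f.hom rfl (algebraMap R (Localization.AtPrime (p.comap f.hom).asIdeal) r)) := h1
  rw [Localization.localRingHom_to_map] at h2
  exact h2

/-! ## The witness: `Spec k[ε] → Spec k` has Teissier branches at its closed point -/

/-- Every conjunct of the predicate `TF` of `TeissierResolve` EXCEPT reducedness holds for the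
fat point `X' = Spec k[ε]` over `S = Spec k` (`π` the structure map, finite; `X'` irreducible):
at the unique (closed) point the completed local ring is `k[ε]` itself, its unique minimal prime
is `(ε)`, and the branch `k[ε]/(ε) = k = k⟦∅⟧` is Teissier-presented with `d = g = 0` (no
variables, no equations), compatibly with `𝒪̂_{S} = k`. [folklore] -/
theorem specDualNumber_teissierBranches (k : Type u) [Field k] :
    ∃ (S : Scheme.{u}) (g : S ⟶ Spec (.of k)) (π : Spec (.of (DualNumber k)) ⟶ S),
      IsSeparated g ∧ LocallyOfFiniteType g ∧ QuasiCompact g ∧ IsIntegral S ∧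
      Scheme.IsRegular S ∧ IrreducibleSpace ↥(Spec (.of (DualNumber k))) ∧ IsFinite π ∧
      ∀ x : ↥(Spec (.of (DualNumber k))), IsClosed ({x} : Set ↥(Spec (.of (DualNumber k)))) →
        ∀ P ∈ minimalPrimes (AdicCompletion
            (maximalIdeal ((Spec (.of (DualNumber k))).presheaf.stalk x))
            ((Spec (.of (DualNumber k))).presheaf.stalk x)),
          ∃ (d : ℕ)
            (φ : AdicCompletion (maximalIdeal (S.presheaf.stalk (π.base x)))
                (S.presheaf.stalk (π.base x)) ≃+* MvPowerSeries (Fin d) k)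
            (ι : MvPowerSeries (Fin d) k →+*
              AdicCompletion (maximalIdeal ((Spec (.of (DualNumber k))).presheaf.stalk x))
                ((Spec (.of (DualNumber k))).presheaf.stalk x) ⧸ P),
            TeissierPresentation k d _ ι ∧
              ∀ a : S.presheaf.stalk (π.base x),
                ι (φ (algebraMap _ _ a)) =
                  Ideal.Quotient.mk P (algebraMap _ _ ((π.stalkMap x).hom a)) := by
  classical
  haveI : Module.Finite k (DualNumber k) := inferInstanceAs (Module.Finite k (k × k))
  haveI : IsArtinianRing (DualNumber k) := IsArtinianRing.of_finite k (DualNumber k)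
  let f : CommRingCat.of k ⟶ CommRingCat.of (DualNumber k) :=
    CommRingCat.ofHom (algebraMap k (DualNumber k))
  refine ⟨Spec (.of k), 𝟙 _, Spec.map f, inferInstance, inferInstance, inferInstance,
    inferInstance, Scheme.isRegular_Spec _, ?_, ?_, ?_⟩
  · -- one point: the nilradical is the maximal ideal `(ε)`, which is prime
    change IrreducibleSpace (PrimeSpectrum (DualNumber k))
    rw [PrimeSpectrum.irreducibleSpace_iff_isPrime_nilradical]
    have h : nilradical (DualNumber k) = maximalIdeal (DualNumber k) := by
      refine le_antisymm (nilradical_le_prime _) fun x hx => ?_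
      rw [DualNumber.maximalIdeal_eq_span_singleton_eps, Ideal.mem_span_singleton'] at hx
      obtain ⟨a, rfl⟩ := hx
      exact mem_nilradical.mpr ⟨2, by
        rw [mul_pow, pow_two DualNumber.eps, DualNumber.eps_mul_eps, mul_zero]⟩
    rw [h]
    infer_instance
  · rw [IsFinite.SpecMap_iff]
    change (algebraMap k (DualNumber k)).Finite
    exact RingHom.finite_algebraMap.mpr inferInstance
  intro x _ P hP
  haveI : P.IsPrime := hP.1.1
  -- the base side: `k → 𝒪_{S,π x}` is bijective, `𝒪_{S, π x} → 𝒪̂` is bijective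
  let q : PrimeSpectrum k := (Spec.map f).base x
  let jS : k →+* (Spec (.of k)).presheaf.stalk q :=
    (Spec.stalkIso (.of k) q).inv.hom.comp (algebraMap k (Localization.AtPrime q.asIdeal))
  have hjS : Function.Bijective jS := by
    refine (Spec.stalkIso (.of k) q).commRingCatIsoToRingEquiv.symm.bijective.comp ?_
    exact Field.localization_map_bijective (M := q.asIdeal.primeCompl)
      (fun h => h (Ideal.zero_mem _))
  haveI : IsArtinianRing ((Spec (.of k)).presheaf.stalk q) := hjS.surjective.isArtinianRing
  let eS := AdicCompletion.ofAlgEquiv (maximalIdeal ((Spec (.of k)).presheaf.stalk q))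
    (S := (Spec (.of k)).presheaf.stalk q)
  let e3 : k ≃+* MvPowerSeries (Fin 0) k :=
    RingEquiv.ofBijective _ (bijective_C_mvPowerSeries_fin_zero k)
  let φ : AdicCompletion (maximalIdeal ((Spec (.of k)).presheaf.stalk q))
      ((Spec (.of k)).presheaf.stalk q) ≃+* MvPowerSeries (Fin 0) k :=
    eS.symm.toRingEquiv.trans ((RingEquiv.ofBijective jS hjS).symm.trans e3)
  -- the fat point side
  let jX : DualNumber k →+* (Spec (.of (DualNumber k))).presheaf.stalk x :=
    (Spec.stalkIso (.of (DualNumber k)) x).inv.hom.comp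
      (algebraMap (DualNumber k) (Localization.AtPrime x.asIdeal))
  have hjX : Function.Surjective jX :=
    (Spec.stalkIso (.of (DualNumber k)) x).commRingCatIsoToRingEquiv.symm.bijective.surjective.comp
      (IsArtinianRing.localization_surjective x.asIdeal.primeCompl _)
  haveI : IsArtinianRing ((Spec (.of (DualNumber k))).presheaf.stalk x) := hjX.isArtinianRing
  have hj : ∀ o : (Spec (.of (DualNumber k))).presheaf.stalk x, ∃ c : k,
      o - (jX.comp (algebraMap k (DualNumber k))) c ∈
        maximalIdeal ((Spec (.of (DualNumber k))).presheaf.stalk x) := by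
    intro o
    obtain ⟨d, rfl⟩ := hjX o
    refine ⟨d.fst, ?_⟩
    change jX d - jX (algebraMap k (DualNumber k) d.fst) ∈ _
    rw [← map_sub]
    have hnil : IsNilpotent (d - algebraMap k (DualNumber k) d.fst) := by
      have hd : d - algebraMap k (DualNumber k) d.fst = TrivSqZeroExt.inr d.snd := by
        ext <;> simp [TrivSqZeroExt.algebraMap_eq_inl]
      rw [hd]
      exact TrivSqZeroExt.isNilpotent_inr _
    exact nilradical_le_prime _ (mem_nilradical.mpr (hnil.map jX))
  have hθ := bijective_quotient_adicCompletion_of_isArtinianRing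
    (jX.comp (algebraMap k (DualNumber k))) hj P
  let eX := RingEquiv.ofBijective _ hθ
  refine ⟨0, φ, eX.toRingHom.comp e3.symm.toRingHom, ?_, fun a => ?_⟩
  · have := (TeissierPresentation.mvPowerSeries k 0).of_ringEquiv (e3.symm.trans eX)
    simpa using this
  · obtain ⟨c, rfl⟩ := hjS.surjective a
    -- naturality of the stalk map on `jS c`
    have hnat : ((Spec.map f).stalkMap x).hom (jS c) = jX (algebraMap k (DualNumber k) c) :=
      stalkMap_stalkIso_inv_algebraMap f x c
    rw [hnat]
    -- the left-hand side computes to `eX c`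
    have h1 : eS.symm (algebraMap _ (AdicCompletion (maximalIdeal ((Spec (.of k)).presheaf.stalk q))
        ((Spec (.of k)).presheaf.stalk q)) (jS c)) = jS c := by
      exact eS.symm_apply_apply (jS c)
    have h2 : (RingEquiv.ofBijective jS hjS).symm (jS c) = c :=
      (RingEquiv.ofBijective jS hjS).symm_apply_apply c
    simp only [RingHom.comp_apply, RingEquiv.toRingHom_eq_coe, RingHom.coe_coe, φ,
      RingEquiv.trans_apply, AlgEquiv.coe_ringEquiv]
    rw [h1, h2, RingEquiv.symm_apply_apply]
    rfl

/-! ## The crux restated, and its irrefutability relative to the summit -/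

/-- `TeissierResolve` is, verbatim up to `teissierPresented_iff`, the statement "every
Teissier-presented scheme over an algebraically closed field of characteristic `p` has a
resolution of singularities". [folklore] -/
theorem teissierResolve_iff :
    Theses.TeissierJung.TeissierResolve ↔
      ∀ p : ℕ, p.Prime → ∀ (k : Type) [Field k] [CharP k p] [IsAlgClosed k],
        ∀ X' : Scheme.{0}, TeissierPresented k X' → Scheme.HasResolution X' := by
  unfold Theses.TeissierJung.TeissierResolve
  refine forall_congr' fun p => forall_congr' fun _ => forall_congr' fun k =>
    forall_congr' fun _ => forall_congr' fun _ => forall_congr' fun _ => forall_congr' fun X' => ?_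
  rw [teissierPresented_iff]

/-- IRREFUTABILITY RELATIVE TO THE SUMMIT: a Teissier-presented `X'` is integral (hence reduced)
and finite over a separated `k`-scheme of finite type, hence itself reduced, separated and of
finite type over `k`; so the summit statement `ResolutionOfSingularities` implies the crux, and a
refutation of `TeissierResolve` would refute resolution of singularities in characteristic `p`
itself. [folklore] -/
theorem not_resolutionOfSingularities_of_not_teissierResolve
    (h : ¬ Theses.TeissierJung.TeissierResolve) : ¬ _root_.ResolutionOfSingularities := by
  intro hR
  apply h
  rw [teissierResolve_iff]
  intro p hp k _ _ _ X' hX'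
  obtain ⟨S, g, π, hsep, hlft, hqc, -, -, hint, hfin, -⟩ := hX'
  haveI := hsep; haveI := hlft; haveI := hqc; haveI := hint; haveI := hfin
  exact (_root_.ResolutionOfSingularities_iff.mp hR p hp) k X' (π ≫ g) inferInstance inferInstance
    inferInstance inferInstance

/-! ## Reducedness of `X'` is load-bearing -/

/-- The hypothesis of the mutated crux below is a WEAKENING of `TeissierPresented k X'`
(`IsIntegral X'` replaced by `IrreducibleSpace X'`, every other conjunct verbatim), so the mutated
crux is a strengthening of `TeissierResolve`. [folklore] -/
theorem teissierPresented_weaken_isIntegral {k : Type u} [Field k] {X' : Scheme.{u}}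
    (h : TeissierPresented k X') :
    ∃ (S : Scheme.{u}) (g : S ⟶ Spec (.of k)) (π : X' ⟶ S),
      IsSeparated g ∧ LocallyOfFiniteType g ∧ QuasiCompact g ∧ IsIntegral S ∧
      Scheme.IsRegular S ∧ IrreducibleSpace X' ∧ IsFinite π ∧
      ∀ x : X', IsClosed ({x} : Set X') →
        ∀ P ∈ minimalPrimes
            (AdicCompletion (maximalIdeal (X'.presheaf.stalk x)) (X'.presheaf.stalk x)),
          ∃ (d : ℕ)
            (φ : AdicCompletion (maximalIdeal (S.presheaf.stalk (π.base x)))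
                (S.presheaf.stalk (π.base x)) ≃+* MvPowerSeries (Fin d) k)
            (ι : MvPowerSeries (Fin d) k →+*
              AdicCompletion (maximalIdeal (X'.presheaf.stalk x)) (X'.presheaf.stalk x) ⧸ P),
            TeissierPresentation k d _ ι ∧
              ∀ a : S.presheaf.stalk (π.base x),
                ι (φ (algebraMap _ _ a)) =
                  Ideal.Quotient.mk P (algebraMap _ _ ((π.stalkMap x).hom a)) := by
  obtain ⟨S, g, π, h1, h2, h3, h4, h5, h6, h7, h8⟩ := h
  haveI := h6
  exact ⟨S, g, π, h1, h2, h3, h4, h5, inferInstance, h7, h8⟩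

/-- **`TeissierResolve` is false without reducedness of `X'`**, at every prime `p`: replace
`IsIntegral X'` by `IrreducibleSpace X'` in the predicate `TF` (all other conjuncts verbatim,
`teissierPresented_iff`) and the conclusion `Scheme.HasResolution X'` fails for the fat point
`X' = Spec 𝔽̄_p[ε] → S = Spec 𝔽̄_p` (`specDualNumber_teissierBranches`: its unique analytic
branch `𝔽̄_p[ε]/(ε) = 𝔽̄_p` is Teissier-presented with `d = g = 0`; and `Spec k[ε]` has no
resolution, `Literature.AlgebraicGeometry.Resolution.not_hasResolution_spec_dualNumber`). MORAL for
provers: the branch condition of `TF` (completed local ring modulo a MINIMAL prime) is blind to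
nilpotents; any proof of the crux must use that `X'` is reduced, i.e. that `𝒪̂_{X',x}` itself —
not only its quotients by minimal primes — is controlled (for `X'` integral and finite over an
excellent regular `S`, `𝒪̂_{X',x}` is reduced: reducedness passes to the completion of a
G-ring, Matsumura 1986, §32, Remark 1). [folklore] -/
theorem teissierResolve_false_without_isReduced (p : ℕ) [Fact p.Prime] :
    ¬ ∀ (k : Type) [Field k] [CharP k p] [IsAlgClosed k] (X' : Scheme.{0}),
      (∃ (S : Scheme.{0}) (g : S ⟶ Spec (.of k)) (π : X' ⟶ S),
        IsSeparated g ∧ LocallyOfFiniteType g ∧ QuasiCompact g ∧ IsIntegral S ∧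
        Scheme.IsRegular S ∧ IrreducibleSpace X' ∧ IsFinite π ∧
        ∀ x : X', IsClosed ({x} : Set X') →
          ∀ P ∈ minimalPrimes
              (AdicCompletion (maximalIdeal (X'.presheaf.stalk x)) (X'.presheaf.stalk x)),
            ∃ (d : ℕ)
              (φ : AdicCompletion (maximalIdeal (S.presheaf.stalk (π.base x)))
                  (S.presheaf.stalk (π.base x)) ≃+* MvPowerSeries (Fin d) k)
              (ι : MvPowerSeries (Fin d) k →+*
                AdicCompletion (maximalIdeal (X'.presheaf.stalk x)) (X'.presheaf.stalk x) ⧸ P),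
              TeissierPresentation k d _ ι ∧
                ∀ a : S.presheaf.stalk (π.base x),
                  ι (φ (algebraMap _ _ a)) =
                    Ideal.Quotient.mk P (algebraMap _ _ ((π.stalkMap x).hom a))) →
      Scheme.HasResolution X' := by
  intro h
  let K : Type := AlgebraicClosure (ZMod p)
  exact not_hasResolution_spec_dualNumber K
    (h K (Spec (.of (DualNumber K))) (specDualNumber_teissierBranches K))

/-- The same with the quantifier prefix of the crux (`∀ p prime, ∀ k …`): the strengthening of
`TeissierResolve` obtained by weakening `IsIntegral X'` to `IrreducibleSpace X'` is false.
[folklore] -/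
theorem teissierResolve_false_without_isReduced' :
    ¬ ∀ p : ℕ, p.Prime → ∀ (k : Type) [Field k] [CharP k p] [IsAlgClosed k] (X' : Scheme.{0}),
      (∃ (S : Scheme.{0}) (g : S ⟶ Spec (.of k)) (π : X' ⟶ S),
        IsSeparated g ∧ LocallyOfFiniteType g ∧ QuasiCompact g ∧ IsIntegral S ∧
        Scheme.IsRegular S ∧ IrreducibleSpace X' ∧ IsFinite π ∧
        ∀ x : X', IsClosed ({x} : Set X') →
          ∀ P ∈ minimalPrimes
              (AdicCompletion (maximalIdeal (X'.presheaf.stalk x)) (X'.presheaf.stalk x)),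
            ∃ (d : ℕ)
              (φ : AdicCompletion (maximalIdeal (S.presheaf.stalk (π.base x)))
                  (S.presheaf.stalk (π.base x)) ≃+* MvPowerSeries (Fin d) k)
              (ι : MvPowerSeries (Fin d) k →+*
                AdicCompletion (maximalIdeal (X'.presheaf.stalk x)) (X'.presheaf.stalk x) ⧸ P),
              TeissierPresentation k d _ ι ∧
                ∀ a : S.presheaf.stalk (π.base x),
                  ι (φ (algebraMap _ _ a)) =
                    Ideal.Quotient.mk P (algebraMap _ _ ((π.stalkMap x).hom a))) →
      Scheme.HasResolution X' := by
  intro h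
  haveI : Fact (Nat.Prime 2) := ⟨Nat.prime_two⟩
  exact teissierResolve_false_without_isReduced 2 (h 2 Nat.prime_two)

end Summit.ResolutionOfSingularities.ResolutionOfSingularities.Theorems.TeissierResolve.Negative

end
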